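import Mathlib
import HarnessLib
import Summits.HubbardSuperconductivity.HubbardSuperconductivity.Theorems.KLProgrammeKLRegimeIsoSectorMultiplierWtBound
import Summits.HubbardSuperconductivity.HubbardSuperconductivity.Theorems.KLProgrammeKLRegimeEngineAnisoTorusSumWtFlow

/-!
# Route `KLProgramme` — engine support (stmt-HubbardSuperconductivity-20437, row (b) producer `hexI`): the geometry datum `hisoW` of
# `isoMomFlowAt_of_wplainLine_isoSingle` DISCHARGED — the weighted isotropic single character sums of `klIsoFamily … (K_n) klE0 m σ` at every resolution
# `m ≥ n` on the FLOW frame `K_n`, bounded by ONE absolute `T_I·M·L²` in the KL regime (brick (F3) of the `hisoW` supplier; cell gate-hubbard-kl, seat p3 g24)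

The isotropic twin of p3 g10's W1 `anisoTorusSumWt_flow_rates`: the frame-keyed uniform bound `charSumWt_klIso_le_uniform` (brick (F2)) on the flow frame
`K_n = klFlowFrameU … n`, whose `C²` size is `≤ κ₀/4` by `FrameOK` in the regime and whose ORDER-THREE datum `A₃ = Gfr₃U²4ⁿ/3` (from the history's jets,
`frameShift_high_sizes_of_frameOK`) satisfies `A₃Λ_m² ≤ 1/3072` for every `m ≥ n` (the deep window is free: `4ⁿ/16^m ≤ 1`); the scale thresholds at
resolution `m ≤ n_β + 1` are `regime_scale_thresholds₃`, and `1 ≤ LΛ_m` comes from `β² ≤ L`, `π/(4β) ≤ Λ_m`, `β ≥ 128`.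
* `isoTorusSumWt_flow_uniform` — `∃ T_I ≥ 0`, for every `G P R Q cc` (`R.WF2`, `0 < cc ≤ klEngC₃6 P R`), `μ ∈ klWindowC`,
  `0 < U ≤ min (klEngU₀3 P R cc) (1/(Gfr₃+1))`, `klBetaMin ≤ β ≤ e^{cc/U²}`, `klEngL₃ β U ≤ L`, `klEngM₃ β U L ≤ M`, `1 ≤ n ≤ n_β+1`, `HistP klPredsV17F2 … 0 n`,
  `FrameOK R U n_β μ K_n`, every `m ∈ [n, n_β]` and sector `σ` of `𝒪_{2m}`:
  `Σ_z (1 + (Λ_mβ/2M)|z̃₀| + Λ_m|z̃₁| + Λ_m|z̃₂|)·‖Σ_q χ_q(z)•klIsoFamily … K_n klE0 m σ q‖ ≤ T_I·M·L²` — literally the `hisoW` family at the threshold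
  `min (klEngU₀3 P R cc) (1/(Gfr₃+1))`.
Everything is proved; no definitions, no named facts; nothing asserts superconductivity. [cite: BenfattoGiulianiMastropietro2006, Lemma 2.2, §2.6 (2.81), §2.8 (2.77)]
-/

noncomputable section

namespace Summit.HubbardSuperconductivity.HubbardSuperconductivity.Theorems.TorusFourierL2

set_option linter.dupNamespace false -- summit = problem name (single-conjunct summit), D-0017

open Set Finset Literature.MathematicalPhysics.QuantumLattice Literature.MathematicalPhysics.QuantumLattice.BandSectorCounting
open Literature.MathematicalPhysics.QuantumLattice.FermiRG Literature.Probability.LatticeModels Literature.Analysis.SpecialFunctions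
open Summit.HubbardSuperconductivity.HubbardSuperconductivity.Theorems.DispersionFlow
open Summit.HubbardSuperconductivity.HubbardSuperconductivity.Theorems.KLRegimeSplit
open Summit.HubbardSuperconductivity.HubbardSuperconductivity.Theorems.KLProgrammeLegKernels
open Summit.HubbardSuperconductivity.HubbardSuperconductivity.Theorems.PerturbedFermiCurve
open scoped Real

set_option maxHeartbeats 1600000 in -- long regime bookkeeping with large explicit constants (as p3 g10's W1 `anisoTorusSumWt_flow_rates`)
/-- **The `hisoW` datum of the engine's row (b), DISCHARGED**: one absolute `T_I ≥ 0` bounds the weighted isotropic single character sums of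
`klIsoFamily … (K_n) klE0 m σ` (time rate `Λ_mβ/(2M)`, space rate `Λ_m`) by `T_I·M·L²` for every resolution `m ∈ [n, n_β]` on the flow frame `K_n`, in the KL regime
at the threshold `U ≤ min (klEngU₀3 P R cc) (1/(Gfr₃+1))`. [cite: BenfattoGiulianiMastropietro2006, Lemma 2.2 (2.52)–(2.56), §2.6 (2.81), §2.8 (2.77)] -/
theorem isoTorusSumWt_flow_uniform :
    ∃ T_I : ℝ, 0 ≤ T_I ∧
      ∀ (G : GeoConsts) (P : SplitConsts) (R : RenConsts) (Q : EngConsts) (cc : ℝ), R.WF2 → 0 < cc → cc ≤ EngineV8.klEngC₃6 P R →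
      ∀ μ ∈ klWindowC, ∀ U : ℝ, 0 < U → U ≤ min (EngineV8.klEngU₀3 P R cc) (1 / (R.Gfr 3 + 1)) →
      ∀ β : ℝ, klBetaMin ≤ β → β ≤ Real.exp (cc / U ^ 2) →
      ∀ (L M : ℕ) [NeZero L] [NeZero M], EngineV8.klEngL₃ β U ≤ L → EngineV8.klEngM₃ β U L ≤ M →
      ∀ n : ℕ, 1 ≤ n → n ≤ nScales β + 1 →
        HistP klPredsV17F2 L M G P Q R β U μ 0 n → FrameOK R U (nScales β) μ (klFlowFrameU L M β U μ n) →
        ∀ m, n ≤ m → m ≤ nScales β → ∀ σ : Fin (sectorCount (2 * m)),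
          ∑ z : TorusSite 1 (2 * M) × TorusSite 2 L,
            (1 + klScale klE0 m * β / (2 * M) * |(((z.1 0).valMinAbs : ℤ) : ℝ)| + klScale klE0 m * |(((z.2 0).valMinAbs : ℤ) : ℝ)| +
                klScale klE0 m * |(((z.2 1).valMinAbs : ℤ) : ℝ)|) *
            ‖∑ q : TorusSite 1 (2 * M) × TorusSite 2 L, (torusChar q.1 z.1 * torusChar q.2 z.2) •
              klIsoFamily L M β μ (klFlowFrameU L M β U μ n) klE0 m σ (⟨(q.1 0).val, ZMod.val_lt (q.1 0)⟩, q.2)‖ ≤ T_I * M * (L : ℝ) ^ 2 := by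
  have ha : (-4 : ℝ) < -(6 / 5) := by norm_num
  have hab : (-(6 / 5) : ℝ) ≤ -(1 / 10) := by norm_num
  have hb : (-(1 / 10) : ℝ) < 0 := by norm_num
  -- the window band bounds and the absolute frame-size threshold
  set B : BandBounds (-(6 / 5)) (-(1 / 10)) := bandBounds ha hab hb with hBdef
  set κ₀ : ℝ := min (min (B.Dtmin / 4) (B.rhomin / 4)) (1 / 40) with hκ₀
  have hDt := B.Dtmin_pos
  have hrh := B.rhomin_pos
  have hκ₀pos : 0 < κ₀ := by rw [hκ₀]; exact lt_min (lt_min (by positivity) (by positivity)) (by norm_num)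
  have hκ₀Dt : κ₀ ≤ B.Dtmin / 4 := (min_le_left _ _).trans (min_le_left _ _)
  have hκ₀rh : κ₀ ≤ B.rhomin / 4 := (min_le_left _ _).trans (min_le_right _ _)
  have hκ₀40 : κ₀ ≤ 1 / 40 := min_le_right _ _
  -- the cutoff constants (order three)
  have he : (0 : ℝ) < klE0 := by norm_num [klE0]
  obtain ⟨d₀, hd₀, hd₀1, hd₀2, hd₀3⟩ := exists_abs_derivs3_bgmCutoffSq_le he
  obtain ⟨B₀, hB₀0, hB₀⟩ := exists_norm_iteratedDeriv_sectorWeightCirc_polarAngle_line_le 3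
  have hd : (0 : ℝ) < d₀ + 1 := by linarith
  have hd1 : ∀ u, |deriv (bgmCutoffSq klE0) u| ≤ d₀ + 1 := fun u => (hd₀1 u).trans (by linarith)
  have hd2 : ∀ u, |iteratedDeriv 2 (bgmCutoffSq klE0) u| ≤ d₀ + 1 := fun u => (hd₀2 u).trans (by linarith)
  have hd3 : ∀ u, |iteratedDeriv 3 (bgmCutoffSq klE0) u| ≤ d₀ + 1 := fun u => (hd₀3 u).trans (by linarith)
  have hBa : (0 : ℝ) < B₀ + 1 := by linarith
  have hBo : ∀ (i : ℕ), i ≤ 3 → ∀ (n : ℕ) (ω : ℤ) (θ₀ : ℝ) (q w : Fin 2 → ℝ) (t : ℝ) {r₀ : ℝ}, 0 < r₀ →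
      r₀ ≤ ‖momToComplex (q + t • w)‖ → |sectorRelAngle θ₀ (q + t • w)| < π →
      ‖iteratedDeriv i (fun t : ℝ => sectorWeightCirc n ω (polarAngle (q + t • w))) t‖ ≤
        (3 : ℕ).factorial * (B₀ + 1) * ((1 + (sectorWidth n)⁻¹ * (3 : ℕ).factorial) * ‖momToComplex w‖ / r₀) ^ i := by
    intro i hi n ω θ₀ q w t r₀ hr₀ hr hθ
    refine (hB₀ i hi n ω θ₀ q w t hr₀ hr hθ).trans ?_
    have hX : 0 ≤ ((1 + (sectorWidth n)⁻¹ * (3 : ℕ).factorial) * ‖momToComplex w‖ / r₀) ^ i := by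
      have := sectorWidth_pos n; positivity
    have h2 : (0 : ℝ) ≤ (3 : ℕ).factorial := Nat.cast_nonneg _
    nlinarith [mul_nonneg h2 hX]
  -- the absolute constants
  set A : ℝ := κ₀ / 4 with hAdef
  have hA0 : 0 < A := by rw [hAdef]; positivity
  have hDtA : 0 < B.Dtmin - 2 * A := by rw [hAdef]; linarith
  have hrhA : 0 < 2 * B.rhomin - 4 * A := by rw [hAdef]; linarith
  have hsm := B.smax_pos
  have hπ := Real.pi_pos
  obtain ⟨cT, hcT⟩ : ∃ cT : ℝ, cT = 8 * ((d₀ + 1) * klE0 ^ 6) + 12 * ((d₀ + 1) * klE0 ^ 4) := ⟨_, rfl⟩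
  obtain ⟨κt, hκt⟩ : ∃ κt : ℝ, κt = max 1 cT := ⟨_, rfl⟩
  obtain ⟨r, hr⟩ : ∃ r : ℝ, r = (1 + 3 * π * B.smax * B.Dtmin / (4 * klE0)) / (B.Dtmin - 2 * A) := ⟨_, rfl⟩
  obtain ⟨G₁, hG₁⟩ : ∃ G₁ : ℝ, G₁ = 4 + 2 * A := ⟨_, rfl⟩
  obtain ⟨K₂, hK₂⟩ : ∃ K₂ : ℝ, K₂ = 4 + 4 * A := ⟨_, rfl⟩
  obtain ⟨κ₃, hκ₃⟩ : ∃ κ₃ : ℝ, κ₃ = (8 * ((d₀ + 1) * klE0 ^ 6) + 12 * ((d₀ + 1) * klE0 ^ 4)) * G₁ ^ 3 +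
      (12 * ((d₀ + 1) * klE0 ^ 4) + 6 * ((d₀ + 1) * klE0 ^ 2)) * G₁ * K₂ * klE0 + 2 * ((d₀ + 1) * klE0 ^ 2) * (4 * klE0 ^ 2 + 8 * (1 / 3072)) +
      108 * (B₀ + 1) * ((4 * ((d₀ + 1) * klE0 ^ 4) + 2 * ((d₀ + 1) * klE0 ^ 2)) * G₁ ^ 2 * klE0 + 2 * ((d₀ + 1) * klE0 ^ 2) * K₂ * klE0 ^ 2) +
      1296 * ((d₀ + 1) * klE0 ^ 2) * G₁ * (B₀ + 1) * klE0 ^ 2 + 1296 * (B₀ + 1) * klE0 ^ 3 := ⟨_, rfl⟩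
  obtain ⟨κ, hκ⟩ : ∃ κ : ℝ, κ = max 1 κ₃ := ⟨_, rfl⟩
  obtain ⟨Kc, hKc⟩ : ∃ Kc : ℝ, Kc = κ ^ 2 := ⟨_, rfl⟩
  obtain ⟨κX, hκX⟩ : ∃ κX : ℝ, κX = 4 * (Real.sqrt 2 * π * Real.sqrt Kc + 2 * klE0) ^ 2 + 16 * (π * Real.sqrt Kc / 2 + klE0) ^ 2 := ⟨_, rfl⟩
  obtain ⟨cN, hcN⟩ : ∃ cN : ℝ, cN = (Real.sqrt 2 * (1 + (4 + 4 * A) * r ^ 2 * klE0) / ((2 * B.rhomin - 4 * A) * π) + 2) *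
      (2 * Real.sqrt 2 * r / π + 2) := ⟨_, rfl⟩
  have hκt1 : 1 ≤ κt := by rw [hκt]; exact le_max_left _ _
  have hκt0 : 0 < κt := lt_of_lt_of_le one_pos hκt1
  have hsqt : Real.sqrt (κt ^ 2) = κt := Real.sqrt_sq hκt0.le
  have hκ1 : 1 ≤ κ := by rw [hκ]; exact le_max_left _ _
  have hκp : 0 < κ := lt_of_lt_of_le one_pos hκ1
  have hsqK : Real.sqrt Kc = κ := by rw [hKc]; exact Real.sqrt_sq hκp.le
  set T : ℝ := π * max κt κ / 2 *
    Real.sqrt (32768 * (π * Real.sqrt (κt ^ 2) + 1) * ((1 + 4 * Real.sqrt 2) ^ 2 * κX) * (210 / π * cN)) with hTdef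
  have hT0 : 0 ≤ T := by rw [hTdef]; positivity
  refine ⟨T, hT0, ?_⟩
  intro G P R Q cc hR2 hcc hcc6 μ hμ U hU hUle β hβmin hβc L M _ _ hL3 hM3 n hn1 hnN hhist hfr m hnm hmN σ
  have hRj : ∀ j, 0 ≤ R.Gfr j := EngineV8.gfr_nonneg_of_wf2 hR2
  have hβ0 : 0 < β := pos_of_klBetaMin_le hβmin
  have hcle : cc ≤ κ₀ / (12 * (R.Gfr 2 + 1)) :=
    (hcc6.trans (EngineV8.klEngC₃6_le_klEngC₃3 P R)).trans (EngineV8.klEngC₃3_le_symbolC₃ ha hab hb P hRj)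
  have hU3 : U ≤ min 1 (κ₀ / (24 * (R.Gfr 0 + R.Gfr 1 + 1))) :=
    (hUle.trans (min_le_left _ _)).trans (EngineV8.klEngU₀3_le_symbolU₀ ha hab hb P hRj cc)
  have hU1 : U ≤ 1 := hU3.trans (min_le_left _ _)
  have hUG : U ≤ 1 / (R.Gfr 3 + 1) := hUle.trans (min_le_right _ _)
  have hLβ : β ^ 2 ≤ (L : ℝ) := EngineV8.sq_le_of_klEngL₃_le hL3
  have hMβ : β ≤ (M : ℝ) := EngineV8.le_of_klEngM₃_le hβmin hL3 hM3
  set K : TrigPolyC4v := klFlowFrameU L M β U μ n with hKdef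
  -- the frame's `C²` size is `≤ A = κ₀/4`
  have hlog : 1 ≤ Real.log 4 := by
    have h4 : Real.exp 1 ≤ 4 := by have := Real.exp_one_lt_d9; norm_num at this; linarith
    calc (1 : ℝ) = Real.log (Real.exp 1) := (Real.log_exp 1).symm
      _ ≤ Real.log 4 := Real.log_le_log (Real.exp_pos 1) h4
  have hAK : ∀ p : Momentum, ∀ j ≤ 2, ‖iteratedFDeriv ℝ j (frameShift K) p‖ ≤ A := by
    intro p j hj
    refine (norm_iteratedFDeriv_frameShift_le_of_frameOK_regime hRj hcc.le hβmin hβc hfr p hj).trans ?_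
    have h0 := hRj 0; have h1 := hRj 1; have h2 := hRj 2
    have hUk : U ≤ κ₀ / (24 * (R.Gfr 0 + R.Gfr 1 + 1)) := hU3.trans (min_le_right _ _)
    rw [abs_of_pos hU]
    have hU2 : U ^ 2 ≤ U := by nlinarith only [hU, hU1]
    have hA1 : 2 * R.Gfr 0 * U + 2 * R.Gfr 1 * U ^ 2 ≤ 2 * (R.Gfr 0 + R.Gfr 1 + 1) * U := by
      have := mul_le_mul_of_nonneg_left hU2 h1
      linarith only [this, hU.le]
    have hB1 : 2 * (R.Gfr 0 + R.Gfr 1 + 1) * U ≤ κ₀ / 12 := by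
      have hpos : 0 < 24 * (R.Gfr 0 + R.Gfr 1 + 1) := by positivity
      have := (le_div_iff₀ hpos).mp hUk
      linarith only [this]
    have hC1 : R.Gfr 2 * (cc / Real.log 4) ≤ R.Gfr 2 * cc := mul_le_mul_of_nonneg_left (div_le_self hcc.le hlog) h2
    have hD1 : R.Gfr 2 * cc ≤ κ₀ / 12 := by
      have hpos : 0 < 12 * (R.Gfr 2 + 1) := by positivity
      have := (le_div_iff₀ hpos).mp hcle
      linarith only [this, hcc.le]
    rw [hAdef]; linarith only [hA1, hB1, hC1, hD1, hκ₀pos]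
  -- the order-three frame datum of the FLOW frame from the history's (I-F jets)
  obtain ⟨N, rfl⟩ : ∃ N, n = N + 1 := ⟨n - 1, by omega⟩
  have hh := (histP_klPredsV17F2_iff L M G P Q R β U μ 0 (N + 1)).1 hhist
  have hJ : ∀ m ≤ N, FlowPieceJetsAt L M β U μ R m := fun m hm => (hh m (Nat.lt_succ_of_le hm)).2.1.2.1
  have hGeo : FlowGeometryAt L M β U μ N := (hh N (Nat.lt_succ_self N)).2.1.2.2
  have hK1 : FrameOK R U N μ K := frameOK_klFlowFrameU_succ hJ hGeo
  have hA3 : ∀ p : Momentum, ‖iteratedFDeriv ℝ 3 (frameShift K) p‖ ≤ R.Gfr 3 * U ^ 2 * ((4 : ℝ) ^ (N + 1) / 3) :=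
    (frameShift_high_sizes_of_frameOK hRj hK1).1
  have ha3 : R.Gfr 3 * U ^ 2 * ((4 : ℝ) ^ (N + 1) / 3) * klScale klE0 m ^ 2 ≤ 1 / 3072 := by
    have hΛn : klScale klE0 m = (1 / 32) * ((4 : ℝ) ^ m)⁻¹ := by rw [klScale, klE0]
    have h4pos : (0 : ℝ) < (4 : ℝ) ^ m := by positivity
    have h4pos' : (0 : ℝ) < (4 : ℝ) ^ (N + 1) := by positivity
    have h4le : (4 : ℝ) ^ (N + 1) ≤ (4 : ℝ) ^ m := pow_le_pow_right₀ (by norm_num) hnm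
    have h41 : (1 : ℝ) ≤ (4 : ℝ) ^ m := one_le_pow₀ (by norm_num)
    have hG3 := hRj 3
    have hGU : R.Gfr 3 * U ^ 2 ≤ 1 := by
      have h1 : R.Gfr 3 * U ≤ 1 :=
        calc R.Gfr 3 * U ≤ R.Gfr 3 * (1 / (R.Gfr 3 + 1)) := mul_le_mul_of_nonneg_left hUG hG3
          _ = R.Gfr 3 / (R.Gfr 3 + 1) := by ring
          _ ≤ 1 := by rw [div_le_one (by positivity)]; linarith only [hG3]
      calc R.Gfr 3 * U ^ 2 = (R.Gfr 3 * U) * U := by ring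
        _ ≤ 1 * 1 := mul_le_mul h1 hU1 hU.le zero_le_one
        _ = 1 := by ring
    rw [hΛn]
    have e : R.Gfr 3 * U ^ 2 * ((4 : ℝ) ^ (N + 1) / 3) * ((1 / 32) * ((4 : ℝ) ^ m)⁻¹) ^ 2 =
        R.Gfr 3 * U ^ 2 / 3072 * ((4 : ℝ) ^ (N + 1) * ((4 : ℝ) ^ m)⁻¹ * ((4 : ℝ) ^ m)⁻¹) := by
      field_simp
      ring
    rw [e]
    have hinv : ((4 : ℝ) ^ m)⁻¹ ≤ 1 := inv_le_one_of_one_le₀ h41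
    have hrat : (4 : ℝ) ^ (N + 1) * ((4 : ℝ) ^ m)⁻¹ ≤ 1 := by
      rw [← div_eq_mul_inv, div_le_one h4pos]; exact h4le
    have hprod : (4 : ℝ) ^ (N + 1) * ((4 : ℝ) ^ m)⁻¹ * ((4 : ℝ) ^ m)⁻¹ ≤ 1 :=
      calc (4 : ℝ) ^ (N + 1) * ((4 : ℝ) ^ m)⁻¹ * ((4 : ℝ) ^ m)⁻¹ ≤ 1 * 1 := mul_le_mul hrat hinv (by positivity) zero_le_one
        _ = 1 := by ring
    calc R.Gfr 3 * U ^ 2 / 3072 * ((4 : ℝ) ^ (N + 1) * ((4 : ℝ) ^ m)⁻¹ * ((4 : ℝ) ^ m)⁻¹) ≤ 1 / 3072 * 1 :=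
          mul_le_mul (by linarith) hprod (by positivity) (by norm_num)
      _ = 1 / 3072 := by ring
  -- the window margins
  have hμ' := hμ
  simp only [klWindowC, Set.mem_Icc] at hμ'
  have e1 : (-1.05 : ℝ) = -(21 / 20) := by norm_num
  have e2 : (-0.15 : ℝ) = -(3 / 20) := by norm_num
  have hμlo : -(21 / 20 : ℝ) ≤ μ := by rw [← e1]; exact hμ'.1
  have hμhi : μ ≤ -(3 / 20 : ℝ) := by rw [← e2]; exact hμ'.2
  have he0 : klE0 = 1 / 32 := rfl
  have hgap : klE0 + A + (1 / 10 : ℝ) ^ 2 < -μ := by rw [he0, hAdef]; linarith only [hμhi, hκ₀40]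
  have h3 : klE0 + A - μ ≤ 3 := by rw [he0, hAdef]; linarith only [hμlo, hκ₀40]
  have hlo : (-(6 / 5) : ℝ) ≤ μ - A - klE0 := by rw [he0, hAdef]; linarith only [hμlo, hκ₀40]
  have hhi : μ + A + klE0 ≤ -(1 / 10) := by rw [he0, hAdef]; linarith only [hμhi, hκ₀40]
  have hADt : 2 * A < B.Dtmin := by rw [hAdef]; linarith
  have hρA : 4 * A < 2 * B.rhomin := by rw [hAdef]; linarith
  -- the scale thresholds at resolution `m ≤ n_β + 1`, and `1 ≤ LΛ_m`
  obtain ⟨hM, hMβ', hLz, -, hΛβ⟩ := regime_scale_thresholds₃ hβmin hLβ hMβ (n := m) (by omega)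
  have hL0 : (0 : ℝ) < L := Nat.cast_pos.2 (Nat.pos_of_ne_zero (NeZero.ne L))
  have hLz' : 3 * |2 * π / (L : ℝ)| ≤ 1 / 10 := by
    have h2m : (1 : ℝ) ≤ (2 : ℝ) ^ m := one_le_pow₀ (by norm_num)
    have h0 : 0 ≤ 3 * |2 * π / (L : ℝ)| := by positivity
    calc 3 * |2 * π / (L : ℝ)| = 3 * |2 * π / (L : ℝ)| * 1 := (mul_one _).symm
      _ ≤ 3 * |2 * π / (L : ℝ)| * ((2 : ℝ) ^ m + 1 / 2) := mul_le_mul_of_nonneg_left (by linarith only [h2m]) h0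
      _ ≤ 1 / 10 := hLz
  have hβ128 : 128 ≤ β := by simpa [klBetaMin] using hβmin
  have hLΛ : 1 ≤ (L : ℝ) * klScale klE0 m := by
    have hΛ0 : 0 < klScale klE0 m := by rw [klScale, klE0]; positivity
    have h1 : π / (4 * β) * β ^ 2 ≤ klScale klE0 m * L := mul_le_mul hΛβ hLβ (by positivity) hΛ0.le
    have h2 : π / (4 * β) * β ^ 2 = π * β / 4 := by field_simp
    have hπ3 := Real.pi_gt_three
    rw [mul_comm]
    rw [h2] at h1
    nlinarith [h1, hπ3, hβ128]
  -- the weighted iso bound on the admissible frame `K_n` at resolution `m`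
  have hmain := charSumWt_klIso_le_uniform (L := L) (M := M) (μ := μ) (K := K) B hAK hADt hA3 he (by norm_num : (0 : ℝ) < 1 / 10)
    (by norm_num : (1 / 10 : ℝ) ≤ 1) hgap h3 hlo hhi hβ0 hρA σ hd.le hd1 hd2 hd3
    (Z := fun p => gnCutoff ((π + 1 / 10) ^ 2 / π ^ 2) ((π + 1 / 10) ^ 2) (p 0 ^ 2) *
      gnCutoff ((π + 1 / 10) ^ 2 / π ^ 2) ((π + 1 / 10) ^ 2) (p 1 ^ 2) *
      (radialCutoffC (1 / 2) (momToComplex p) * sectorWeightCirc (2 * m) ((σ : ℕ) : ℤ) (polarAngle p)))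
    (fun p => rfl)
    (Φ := fun kp => ((bgmCutoffSq klE0 ((16 : ℝ) ^ m * (kp.1 ^ 2 + frameLevel μ K (WithLp.toLp 2 kp.2) ^ 2)) *
      (gnCutoff ((π + 1 / 10) ^ 2 / π ^ 2) ((π + 1 / 10) ^ 2) (kp.2 0 ^ 2) *
        gnCutoff ((π + 1 / 10) ^ 2 / π ^ 2) ((π + 1 / 10) ^ 2) (kp.2 1 ^ 2) *
        (radialCutoffC (1 / 2) (momToComplex kp.2) * sectorWeightCirc (2 * m) ((σ : ℕ) : ℤ) (polarAngle kp.2))) : ℝ) : ℂ))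
    (fun k₀ p => rfl)
    (Gs := fun q : TorusSite 1 (2 * M) × TorusSite 2 L => klIsoFamily L M β μ K klE0 m σ (⟨(q.1 0).val, ZMod.val_lt (q.1 0)⟩, q.2))
    (fun q => rfl) hBa hBo hcT hκt hG₁ hK₂ hκ₃ hκ hKc hr hκX hcN ha3 hM hMβ' hLz' hLΛ hΛβ
  rw [hTdef]
  refine hmain.trans (le_of_eq ?_)
  ring

end Summit.HubbardSuperconductivity.HubbardSuperconductivity.Theorems.TorusFourierL2

end
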